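import Literature.AlgebraicGeometry.Motives.FaltingsECEndCorePotentialCMProofs
import Literature.NumberTheory.EllipticCurves.KernelReductionInertiaProofs
import Literature.NumberTheory.EllipticCurves.InertiaAboveEllCyclotomicProofs
import Literature.NumberTheory.EllipticCurves.TateModuleFixedPointsProofs
import HarnessLib

/-!
# Faltings 1983, Satz 4 for an elliptic curve: the core fact at a place `v ∣ ℓ` of good ordinary
# reduction (Serre 1968, IV.2.2 with A.2.2)

Theorem-only `Proofs` companion of `Literature.AlgebraicGeometry.Motives.FaltingsECEndCore` (the
named fact `exists_eq_smul_one_of_equivariant_of_not_hasRationalCM W ℓ`: for an elliptic curve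
`E` over a number field `K` with `End_K(E) = ℤ` and `V_ℓ E` without `Γ_K`-stable `ℚ_ℓ`-line,
`End_{Γ_K}(V_ℓ E) = ℚ_ℓ` — the residual core of Faltings 1983, §5 Satz 4 for `A = E`, equivalently
"the `ℓ`-adic image of `Γ_K` is not abelian", J.-P. Serre, *Abelian ℓ-adic representations and
elliptic curves* (1968), IV.2.2), continuing `FaltingsECEndCoreCasesProofs` (real place,
multiplicative place `v ∤ ℓ`, `ord_v(j) < 0` at `v ∤ ℓ`) and `FaltingsECEndCorePotentialCMProofs`
(complex multiplication over `K̄`).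

This file **proves the core fact for a curve with a place `v ∣ ℓ` (`ℓ` odd) of good ordinary
reduction**, following Serre's local analysis at a
place of good reduction of height `1` (1968, IV, Appendix A.2.2): the Tate module of the formal
group `X = T_ℓ(Ê) ⊂ T_ℓ E` is a line on which inertia acts through `χ_ℓ`, and inertia acts
trivially on `T_ℓ E / X`; hence an inertia element `τ` with `χ_ℓ(τ) ≠ 1` acts on the plane
`V_ℓ E` with the eigenvalue `1` of multiplicity exactly one, which no element of a non-split
Cartan subgroup does.  In the tree's finite-level language:

* the local input is `WeierstrassCurve.card_map_smul_sub_geomTorsion_le_pow`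
  (`KernelReductionInertiaProofs`): for `τ ∈ I_𝔓`, `𝔓 ∣ v`, `#((τ - 1) E[ℓᵐ]) ≤ ℓᵐ` for all `m`
  (inertia moves points into the kernel of reduction, Silverman *AEC* VII.2.1, whose `ℓᵐ`-torsion
  has `≤ ℓᵐ` points at an ordinary place, `KernelReductionOrdinaryTorsionProofs`, from
  `deg ΨSq_ℓ ≡ ℓ² - ℓ`, `DivisionPolynomialFormalMulProofs`);
* `not_surjective_rationalGaloisRepTate_sub_one` — hence `ρ_ℓ(τ) - 1` is not surjective on
  `V_ℓ E` (else `(T_ℓ(τ) - 1) T_ℓ E ⊇ ℓᵏ T_ℓ E` and `ℓᵏ E[ℓᵐ] ⊆ (τ - 1) E[ℓᵐ]` would have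
  `ℓ^{2m-2k} > ℓᵐ` elements for `m = 2k + 1`; `#E[ℓⁿ] = ℓ^{2n}`, *AEC* III.6.4, and the
  surjectivity of `T_ℓ E → E[ℓⁿ]`);
* `rationalGaloisRepTate_ne_one_of_cyclotomicCharacter_ne_one` — `ρ_ℓ(τ) ≠ 1` when
  `χ_ℓ(τ) ≠ 1` (`det ρ_ℓ = χ_ℓ`, *AEC* III.8.3, `det_galoisRepTate_eq_cyclotomicCharacter`), and
  such `τ ∈ I_𝔓` exist above `ℓ` (`exists_mem_inertia_cyclotomicCharacter_ne_one`,
  `InertiaAboveEllCyclotomicProofs`);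
* `exists_eq_smul_one_of_equivariant_of_isUnit_hasseCoeff` — so `τ` fixes exactly a line of
  `V_ℓ E` and `exists_eq_smul_one_of_forall_commute_of_fixed_line` (`FaltingsECEndCoreCasesProofs`)
  gives the scalar commutant; `…_of_not_hasRationalCM_of_isUnit_hasseCoeff` (the named fact),
  `mem_span_range_tateEndRingHom_iff_…` (**Faltings' Satz 4 for such `E`**, unconditionally),
  `stable_subspace_prod_eq_range_…` (the subspace statement for `E × E`),
  `mem_span_range_tateModule_map_of_equivariant_self_…` (Korollar 1 for `(E, E)`);
* `exists_eq_smul_one_of_equivariant_of_not_hasRationalCM_of_residual'` — the frontier: the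
  named fact over a number field now reduces to `¬ HasCM`, `K` totally imaginary, `j` integral at
  all `v ∤ ℓ`, and (`ℓ = 2` or) no ordinary good place above `ℓ` (the potential version, over a
  finite extension `L/K`, follows with `FaltingsECEndCoreBaseChangeProofs` in a sequel).

"Ordinary good place above `ℓ`" is expressed by explicit data: a Weierstrass model `M` over
`𝓞_v` of `E ⊗ K_v` (`C • E_{K_v} = M_{K_v}`) with `Δ(M) ∈ 𝓞_vˣ` and unit Hasse invariant
`A_ℓ(M) = WeierstrassCurve.hasseCoeff M ℓ` (Silverman *AEC* V.4.1(a); for `ℓ` odd).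

## References

* [SerreAbelianLadic1968] J.-P. Serre, *Abelian ℓ-adic representations and elliptic curves*,
  Benjamin 1968, Ch. IV §2.2 (Theorem) and Appendix A.2.2 (good reduction of height 1).
* [Faltings1983Endlichkeit] G. Faltings, Invent. Math. 73 (1983), §5 Satz 4 and Korollar 1;
  transl. Cornell–Silverman, *Arithmetic Geometry*, Ch. II §5 (held, PDF pp. 89–90).
* [SilvermanAEC2009] J. H. Silverman, *The Arithmetic of Elliptic Curves*, 2nd ed.: III.6.4,
  III.§7, III.8.3, V.4.1(a), VII.2.1.

## Design

Theorems only; `noncomputable section`; one universe `u`; conventions of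
`FaltingsECEndCoreCasesProofs` (`rationalGaloisRepTate`, hypotheses `hnl`/`hG`) and of
`KernelReductionInertiaProofs` (`(C, M)`, `absIntegers`, `primesAbove`, `Ideal.inertia`).
-/

noncomputable section

open scoped TensorProduct

universe u

namespace Literature.AlgebraicGeometry.Motives

open WeierstrassCurve Module Literature.NumberTheory.EllipticCurves
  Literature.NumberTheory.GaloisRepresentations Field IsDedekindDomain
open scoped NumberField

/-! ## `(σ - 1) E[ℓᵐ]` small for all `m` ⇒ `ρ_ℓ(σ) - 1` is not invertible on `V_ℓ E` -/

section RankLemma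

variable {K : Type u} [Field K] (W : WeierstrassCurve K) (ℓ : ℕ) [hℓ : Fact ℓ.Prime]

/-- `V_ℓ(σ) - 1` on `1 ⊗ x` is `1 ⊗ (T_ℓ(σ) x - x)`. [folklore] -/
theorem rationalGaloisRepTate_sub_one_toRational (σ : Field.absoluteGaloisGroup K)
    (x : W.tateModule ℓ) :
    (rationalGaloisRepTate W ℓ σ - 1 : Module.End ℚ_[ℓ] (W.rationalTateModule ℓ))
        (TateModule.toRational ℓ x) =
      TateModule.toRational ℓ (W.galoisRepTate ℓ σ x - x) := by
  rw [LinearMap.sub_apply, Module.End.one_apply, map_sub]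
  congr 1

/-- The `n`-th component of `T_ℓ(σ) x - x` is `σ • x_n - x_n`. [folklore] -/
theorem proj_galoisRepTate_sub (σ : Field.absoluteGaloisGroup K) (x : W.tateModule ℓ) (n : ℕ) :
    TateModule.proj ℓ n (W.galoisRepTate ℓ σ x - x) =
      σ • TateModule.proj ℓ n x - TateModule.proj ℓ n x := by
  rw [map_sub, galoisRepTate_apply_apply, TateModule.proj_smul_of_distribMulAction]

/-- **If `#((σ - 1) E[ℓᵐ]) ≤ ℓᵐ` for all `m`, then `ρ_ℓ(σ) - 1` is not surjective on `V_ℓ E`.**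
For an elliptic curve `E/K`, a prime `ℓ ≠ char K` and `σ ∈ Γ_K` such that for every `m` the
image of `E[ℓᵐ]` under `P ↦ P^σ - P` has at most `ℓᵐ` elements, the endomorphism `ρ_ℓ(σ) - 1` of
the plane `V_ℓ E` is not surjective (so has rank `≤ 1`).  Otherwise `(T_ℓ(σ) - 1)(T_ℓ E)` would
have finite index in `T_ℓ E` (denominators in `V_ℓ E = ℚ_ℓ ⊗ T_ℓ E` and finite generation of
`T_ℓ E`), i.e. contain `ℓᵏ T_ℓ E`; projecting to level `m` (`T_ℓ E → E[ℓᵐ]` is onto,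
`proj_surjective_of_isAlgClosed_holds`) gives `ℓᵏ E[ℓᵐ] ⊆ (σ - 1) E[ℓᵐ]`, and
`#(ℓᵏ E[ℓᵐ]) = ℓ^{2m - 2k}` (`#E[ℓⁿ] = ℓ^{2n}`, *AEC* III.6.4) exceeds `ℓᵐ` for `m = 2k + 1`.
[Serre 1968, IV, A.2.2 (`T_ℓ(Ê)` is a line)] [cite: SerreAbelianLadic1968, IV A.2.2] -/
theorem not_surjective_rationalGaloisRepTate_sub_one [W.IsElliptic] (hℓK : (ℓ : K) ≠ 0)
    (σ : Field.absoluteGaloisGroup K)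
    (hcard : ∀ m : ℕ, Nat.card ((geomTorsion W ((ℓ ^ m : ℕ) : ℤ)).map
      (DistribSMul.toAddMonoidHom (geomPoints W) σ - AddMonoidHom.id (geomPoints W))) ≤ ℓ ^ m) :
    ¬ Function.Surjective
      (rationalGaloisRepTate W ℓ σ - 1 : Module.End ℚ_[ℓ] (W.rationalTateModule ℓ)) := by
  intro hsurj
  haveI := module_finite_tateModule_holds W ℓ
  set fT : W.tateModule ℓ →ₗ[ℤ_[ℓ]] W.tateModule ℓ := W.galoisRepTate ℓ σ - 1 with hfT
  have hfT_apply : ∀ x, fT x = W.galoisRepTate ℓ σ x - x := fun x ↦ rfl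
  -- Step 1: every `x ∈ T_ℓ E` has a non-zero multiple in the image of `T_ℓ(σ) - 1`
  have step1 : ∀ x : W.tateModule ℓ, ∃ N : ℤ_[ℓ], N ≠ 0 ∧ N • x ∈ LinearMap.range fT := by
    intro x
    obtain ⟨z, hz⟩ := hsurj (TateModule.toRational ℓ x)
    obtain ⟨N, hN, y, hy⟩ := RationalTateModule.exists_smul_eq_toRational z
    refine ⟨N, hN, y, ?_⟩
    apply TateModule.toRational_injective (p := ℓ)
    rw [hfT_apply, ← rationalGaloisRepTate_sub_one_toRational, ← hy, map_smul, hz,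
      map_smul]
    exact algebraMap_smul ℚ_[ℓ] N _
  -- Step 2: a single `N ≠ 0` with `N • T_ℓ E ⊆ range`
  obtain ⟨S, hS⟩ := Module.finite_def.mp ‹Module.Finite ℤ_[ℓ] (W.tateModule ℓ)›
  classical
  choose Nf hNf hNmem using step1
  set N : ℤ_[ℓ] := ∏ s ∈ S, Nf s with hN
  have hN0 : N ≠ 0 := Finset.prod_ne_zero_iff.mpr fun s _ ↦ hNf s
  have step2 : ∀ x : W.tateModule ℓ, N • x ∈ LinearMap.range fT := by
    have hgen : ∀ x ∈ Submodule.span ℤ_[ℓ] (S : Set (W.tateModule ℓ)),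
        N • x ∈ LinearMap.range fT := by
      intro x hx
      induction hx using Submodule.span_induction with
      | mem s hs =>
        obtain ⟨M, hM⟩ : Nf s ∣ N := Finset.dvd_prod_of_mem _ hs
        rw [hM, mul_comm, mul_smul]
        exact Submodule.smul_mem _ _ (hNmem s)
      | zero => rw [smul_zero]; exact Submodule.zero_mem _
      | add x y _ _ hx hy => rw [smul_add]; exact Submodule.add_mem _ hx hy
      | smul a x _ hx => rw [smul_comm]; exact Submodule.smul_mem _ _ hx
    intro x
    exact hgen x (by rw [hS]; exact Submodule.mem_top)
  -- Step 3: `N = u ℓᵏ`, so `ℓᵏ T_ℓ E ⊆ range`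
  set k : ℕ := N.valuation with hk
  have step3 : ∀ x : W.tateModule ℓ, (ℓ : ℤ_[ℓ]) ^ k • x ∈ LinearMap.range fT := by
    intro x
    have hu := PadicInt.unitCoeff_spec hN0
    have hx := step2 ((PadicInt.unitCoeff hN0)⁻¹.val • x)
    have hNu : N * (PadicInt.unitCoeff hN0)⁻¹.val = (ℓ : ℤ_[ℓ]) ^ k := by
      conv_lhs => arg 1; rw [hu]
      rw [mul_comm, ← mul_assoc, Units.inv_mul, one_mul, hk]
    rw [← mul_smul, hNu] at hx
    exact hx
  -- Step 4: at level `m = 2k + 1`, `ℓᵏ E[ℓᵐ] ⊆ (σ - 1) E[ℓᵐ]`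
  set m : ℕ := 2 * k + 1 with hm
  set H := (geomTorsion W ((ℓ ^ m : ℕ) : ℤ)).map
    (DistribSMul.toAddMonoidHom (geomPoints W) σ - AddMonoidHom.id (geomPoints W)) with hH
  have step4 : ∀ P ∈ geomTorsion W ((ℓ ^ m : ℕ) : ℤ), ℓ ^ k • P ∈ H := by
    intro P hP
    obtain ⟨a, ha⟩ := proj_surjective_of_isAlgClosed_holds W ℓ m hP
    obtain ⟨b, hb⟩ := step3 a
    refine AddSubgroup.mem_map.mpr ⟨TateModule.proj ℓ m b, ?_, ?_⟩
    · exact proj_tateModule_mem_geomTorsion W ℓ m b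
    · rw [AddMonoidHom.sub_apply, AddMonoidHom.id_apply, DistribSMul.toAddMonoidHom_apply,
        ← proj_galoisRepTate_sub, ← hfT_apply, hb, TateModule.proj_pow_smul, ha]
  -- Step 5: counting
  have hℓK' : ∀ n : ℕ, ((ℓ ^ n : ℕ) : AlgebraicClosure K) ≠ 0 := fun n ↦ by
    rw [Nat.cast_pow]
    exact pow_ne_zero n (by
      rw [← map_natCast (algebraMap K (AlgebraicClosure K)) ℓ]
      exact (map_ne_zero_iff _ (algebraMap K _).injective).mpr hℓK)
  have hcardT : ∀ n : ℕ, Nat.card (geomTorsion W ((ℓ ^ n : ℕ) : ℤ)) = (ℓ ^ n) ^ 2 := fun n ↦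
    (W.baseChange (AlgebraicClosure K)).card_torsionBy_eq_sq (hℓK' n)
  -- the multiplication by `ℓᵏ` on `E[ℓᵐ]`
  set φ : geomTorsion W ((ℓ ^ m : ℕ) : ℤ) →+ geomPoints W :=
    AddMonoidHom.mk' (fun P ↦ ℓ ^ k • (P : geomPoints W)) fun a b ↦ by
      rw [AddSubgroup.coe_add, smul_add] with hφ
  have hφapply : ∀ P, φ P = ℓ ^ k • (P : geomPoints W) := fun P ↦ rfl
  haveI hfin : Finite (geomTorsion W ((ℓ ^ m : ℕ) : ℤ)) := by
    apply Nat.finite_of_card_ne_zero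
    rw [hcardT]
    exact pow_ne_zero 2 (pow_ne_zero m hℓ.out.ne_zero)
  -- range φ ≤ H
  have hrange : φ.range ≤ H := by
    rintro Q ⟨P, rfl⟩
    exact step4 P P.2
  haveI : Finite H := by
    have hHfin : (H : Set (geomPoints W)).Finite := by
      rw [hH, AddSubgroup.coe_map]
      exact (Set.toFinite _).image _
    exact hHfin.to_subtype
  have hcard_range_le : Nat.card φ.range ≤ ℓ ^ m :=
    (Nat.card_mono (Set.toFinite _) hrange).trans (hcard m)
  -- ker φ embeds into `E[ℓᵏ]`
  have hker : Nat.card φ.ker ≤ (ℓ ^ k) ^ 2 := by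
    rw [← hcardT k]
    haveI : Finite (geomTorsion W ((ℓ ^ k : ℕ) : ℤ)) := by
      apply Nat.finite_of_card_ne_zero
      rw [hcardT]
      exact pow_ne_zero 2 (pow_ne_zero k hℓ.out.ne_zero)
    refine Nat.card_le_card_of_injective
      (fun P : φ.ker ↦ (⟨((P : geomTorsion W ((ℓ ^ m : ℕ) : ℤ)) : geomPoints W), ?_⟩ :
        geomTorsion W ((ℓ ^ k : ℕ) : ℤ))) ?_
    · have hP := P.2
      rw [AddMonoidHom.mem_ker, hφapply] at hP
      change ((ℓ ^ k : ℕ) : ℤ) • ((P : geomTorsion W ((ℓ ^ m : ℕ) : ℤ)) : geomPoints W) = 0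
      rw [natCast_zsmul]
      exact hP
    · intro P Q hPQ
      have := congrArg Subtype.val hPQ
      exact Subtype.ext (Subtype.ext this)
  -- `#E[ℓᵐ] = #ker φ · #range φ`
  have hmul : Nat.card (geomTorsion W ((ℓ ^ m : ℕ) : ℤ)) =
      Nat.card φ.ker * Nat.card φ.range := by
    rw [AddSubgroup.card_eq_card_quotient_mul_card_addSubgroup φ.ker, mul_comm,
      Nat.card_congr (QuotientAddGroup.quotientKerEquivRange φ).toEquiv]
  rw [hcardT] at hmul
  -- `ℓ^{2m} ≤ ℓ^{2k} · ℓ^m` with `m = 2k + 1`: contradiction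
  have h1 : (ℓ ^ m) ^ 2 ≤ (ℓ ^ k) ^ 2 * ℓ ^ m := by
    rw [hmul]; exact Nat.mul_le_mul hker hcard_range_le
  have h2 : (ℓ ^ k) ^ 2 * ℓ ^ m < (ℓ ^ m) ^ 2 := by
    rw [hm, ← pow_mul, ← pow_add, ← pow_mul]
    exact Nat.pow_lt_pow_right hℓ.out.one_lt (by omega)
  exact absurd h1 (not_le.mpr h2)

end RankLemma

/-! ## The core fact at a place `v ∣ ℓ` of good ordinary reduction -/

section Ordinary

variable {K : Type u} [Field K] (W : WeierstrassCurve K) (ℓ : ℕ) [hℓ : Fact ℓ.Prime]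

/-- **`det ρ_ℓ(τ) = χ_ℓ(τ)` on `V_ℓ E`** (from `det_galoisRepTate_eq_cyclotomicCharacter` on
`T_ℓ E`, *AEC* III.8.3, and `LinearMap.det_baseChange`). [cite: SilvermanAEC2009, Prop. III.8.3] -/
theorem det_rationalGaloisRepTate_eq_cyclotomicCharacter [CharZero K] [W.IsElliptic]
    (τ : Field.absoluteGaloisGroup K) :
    LinearMap.det (rationalGaloisRepTate W ℓ τ :
      W.rationalTateModule ℓ →ₗ[ℚ_[ℓ]] W.rationalTateModule ℓ) =
        algebraMap ℤ_[ℓ] ℚ_[ℓ] ((GaloisRep.cyclotomicCharacter K ℓ τ : ℤ_[ℓ]ˣ) : ℤ_[ℓ]) := by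
  haveI : PerfectField K := PerfectField.ofCharZero
  have hℓK : (ℓ : K) ≠ 0 := Nat.cast_ne_zero.mpr hℓ.out.ne_zero
  haveI := module_free_tateModule_holds W ℓ
  haveI := module_finite_tateModule_holds W ℓ
  change LinearMap.det ((W.galoisRepTate ℓ τ).baseChange ℚ_[ℓ]) = _
  rw [LinearMap.det_baseChange, det_galoisRepTate_eq_cyclotomicCharacter W ℓ hℓK
    (fun n ↦ exists_weilPairing_holds W (ℓ ^ (n + 1))) τ]

/-- An element of `Γ_K` with `χ_ℓ(τ) ≠ 1` acts non-trivially on `V_ℓ E`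
(`det ρ_ℓ(τ) = χ_ℓ(τ)`). [cite: SilvermanAEC2009, Prop. III.8.3] -/
theorem rationalGaloisRepTate_ne_one_of_cyclotomicCharacter_ne_one [CharZero K] [W.IsElliptic]
    {τ : Field.absoluteGaloisGroup K} (hχ : GaloisRep.cyclotomicCharacter K ℓ τ ≠ 1) :
    rationalGaloisRepTate W ℓ τ ≠ 1 := by
  intro h1
  apply hχ
  have hdet := det_rationalGaloisRepTate_eq_cyclotomicCharacter W ℓ τ
  rw [h1] at hdet
  have h1' : LinearMap.det ((1 : Module.End ℚ_[ℓ] (W.rationalTateModule ℓ)) :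
      W.rationalTateModule ℓ →ₗ[ℚ_[ℓ]] W.rationalTateModule ℓ) = 1 := LinearMap.det_id
  rw [h1', eq_comm, ← map_one (algebraMap ℤ_[ℓ] ℚ_[ℓ])] at hdet
  exact Units.ext ((IsFractionRing.injective ℤ_[ℓ] ℚ_[ℓ]) hdet)

/-- **The core of Satz 4 at a place `v ∣ ℓ` of good ordinary reduction, from an inertia element
with `χ_ℓ ≠ 1`.**  Let `E/K` be an elliptic curve over a number field, `ℓ` an odd prime,
`v ∣ ℓ` a finite place with an ordinary good model `M/𝓞_v` (`C • E_{K_v} = M_{K_v}`, `Δ(M)` and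
the Hasse invariant `A_ℓ(M)` units), `𝔓 ∣ v`, `τ ∈ I_𝔓` with `χ_ℓ(τ) ≠ 1`, and suppose `V_ℓ E`
has no `Γ_K`-stable line.  Then every `Γ_K`-equivariant endomorphism of `V_ℓ E` is a scalar.
Indeed `ρ_ℓ(τ) - 1` is non-zero (`det ρ_ℓ(τ) = χ_ℓ(τ) ≠ 1`) and not surjective
(`not_surjective_rationalGaloisRepTate_sub_one` with `card_map_smul_sub_geomTorsion_le_pow`), so
`τ` fixes exactly a line of the plane `V_ℓ E`, and `exists_eq_smul_one_of_forall_commute_of_fixed_line`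
applies: the image of `Γ_K` is not in a non-split Cartan subgroup, as it contains an element with
the rational eigenvalue `1` of multiplicity one (Serre 1968, IV.2.2 with A.2.2).
[cite: SerreAbelianLadic1968, IV.2.2 and A.2.2] -/
theorem exists_eq_smul_one_of_equivariant_of_isUnit_hasseCoeff_of_mem_inertia [NumberField K]
    [W.IsElliptic] {v : HeightOneSpectrum (𝓞 K)} (hℓv : (ℓ : 𝓞 K) ∈ v.asIdeal) (hℓ2 : ℓ ≠ 2)
    {C : VariableChange (v.adicCompletion K)} {M : WeierstrassCurve (v.adicCompletionIntegers K)}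
    (hCM : C • W.baseChange (v.adicCompletion K) =
      M.map (algebraMap (v.adicCompletionIntegers K) (v.adicCompletion K))) (hΔ : IsUnit M.Δ)
    (hA : IsUnit (M.hasseCoeff ℓ))
    {𝔓 : Ideal (absIntegers (𝓞 K) K)} (h𝔓 : 𝔓 ∈ v.primesAbove)
    {τ : Field.absoluteGaloisGroup K} (hτ : τ ∈ 𝔓.inertia (Field.absoluteGaloisGroup K))
    (hχ : GaloisRep.cyclotomicCharacter K ℓ τ ≠ 1)
    (hnl : ∀ L : Submodule ℚ_[ℓ] (W.rationalTateModule ℓ),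
      (∀ σ : Field.absoluteGaloisGroup K, ∀ v ∈ L, rationalGaloisRepTate W ℓ σ v ∈ L) →
        Module.finrank ℚ_[ℓ] L ≠ 1)
    (G : Module.End ℚ_[ℓ] (W.rationalTateModule ℓ))
    (hG : ∀ (σ : Field.absoluteGaloisGroup K) (v : W.rationalTateModule ℓ),
      G (rationalGaloisRepTate W ℓ σ v) = rationalGaloisRepTate W ℓ σ (G v)) :
    ∃ c : ℚ_[ℓ], G = c • 1 := by
  have hℓK : (ℓ : K) ≠ 0 := Nat.cast_ne_zero.mpr hℓ.out.ne_zero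
  have h2 := finrank_rationalTateModule_eq_two_holds W ℓ hℓK
  haveI : Module.Finite ℚ_[ℓ] (W.rationalTateModule ℓ) := module_finite_rationalTateModule_holds W ℓ
  set f : Module.End ℚ_[ℓ] (W.rationalTateModule ℓ) := rationalGaloisRepTate W ℓ τ - 1 with hf
  -- `f` is not surjective ...
  have hns : ¬ Function.Surjective f := not_surjective_rationalGaloisRepTate_sub_one W ℓ hℓK τ
    fun m ↦ W.card_map_smul_sub_geomTorsion_le_pow hℓ2 hℓv hCM hΔ hA h𝔓 hτ m
  -- ... and non-zero
  have hf0 : f ≠ 0 := fun h0 ↦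
    rationalGaloisRepTate_ne_one_of_cyclotomicCharacter_ne_one W ℓ hχ (sub_eq_zero.mp h0)
  -- so its kernel is a line
  have hrange_lt : Module.finrank ℚ_[ℓ] (LinearMap.range f) < 2 := by
    rw [← h2]
    exact Submodule.finrank_lt (mt LinearMap.range_eq_top.mp hns)
  have hrange_pos : 0 < Module.finrank ℚ_[ℓ] (LinearMap.range f) := by
    rw [Module.finrank_pos_iff_exists_ne_zero]
    by_contra hall
    push Not at hall
    apply hf0
    refine LinearMap.ext fun w ↦ ?_
    have := hall ⟨f w, LinearMap.mem_range_self f w⟩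
    rw [Subtype.ext_iff] at this
    exact this
  have hker : Module.finrank ℚ_[ℓ] (LinearMap.ker f) = 1 := by
    have hrn := LinearMap.finrank_range_add_finrank_ker f
    rw [h2] at hrn
    omega
  refine exists_eq_smul_one_of_forall_commute_of_fixed_line h2
    (fun σ ↦ rationalGaloisRepTate W ℓ σ) ({τ} : Set (Field.absoluteGaloisGroup K))
    (L := LinearMap.ker f) (fun w ↦ ?_) hker hnl fun σ ↦ LinearMap.ext fun w ↦ hG σ w
  simp only [Set.mem_singleton_iff, forall_eq, LinearMap.mem_ker, hf, LinearMap.sub_apply,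
    Module.End.one_apply, sub_eq_zero]

/-- **The core of Satz 4 at a place `v ∣ ℓ` of good ordinary reduction** (`ℓ` odd): for an
elliptic curve `E` over a number field `K` with an ordinary good model `M/𝓞_v` at a place `v ∣ ℓ`
(`C • E_{K_v} = M_{K_v}`, `Δ(M), A_ℓ(M) ∈ 𝓞_vˣ`), if `V_ℓ E` has no `Γ_K`-stable line then every
`Γ_K`-equivariant endomorphism of `V_ℓ E` is a scalar — some `τ` in an inertia group above `v`
has `χ_ℓ(τ) ≠ 1` (`exists_mem_inertia_cyclotomicCharacter_ne_one`) and the previous theorem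
applies.  This is Serre 1968, IV.2.2 in the case of a place above `ℓ` of good reduction of height
`1` (A.2.2): the `ℓ`-adic image is not contained in a non-split Cartan subgroup.  No hypothesis on
`End_K(E)`. [cite: SerreAbelianLadic1968, IV.2.2 and A.2.2] -/
theorem exists_eq_smul_one_of_equivariant_of_isUnit_hasseCoeff [NumberField K] [W.IsElliptic]
    {v : HeightOneSpectrum (𝓞 K)} (hℓv : (ℓ : 𝓞 K) ∈ v.asIdeal) (hℓ2 : ℓ ≠ 2)
    {C : VariableChange (v.adicCompletion K)} {M : WeierstrassCurve (v.adicCompletionIntegers K)}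
    (hCM : C • W.baseChange (v.adicCompletion K) =
      M.map (algebraMap (v.adicCompletionIntegers K) (v.adicCompletion K))) (hΔ : IsUnit M.Δ)
    (hA : IsUnit (M.hasseCoeff ℓ))
    (hnl : ∀ L : Submodule ℚ_[ℓ] (W.rationalTateModule ℓ),
      (∀ σ : Field.absoluteGaloisGroup K, ∀ v ∈ L, rationalGaloisRepTate W ℓ σ v ∈ L) →
        Module.finrank ℚ_[ℓ] L ≠ 1)
    (G : Module.End ℚ_[ℓ] (W.rationalTateModule ℓ))
    (hG : ∀ (σ : Field.absoluteGaloisGroup K) (v : W.rationalTateModule ℓ),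
      G (rationalGaloisRepTate W ℓ σ v) = rationalGaloisRepTate W ℓ σ (G v)) :
    ∃ c : ℚ_[ℓ], G = c • 1 := by
  obtain ⟨𝔓, h𝔓⟩ := HeightOneSpectrum.primesAbove_nonempty v
  obtain ⟨τ, hτ, hχ⟩ := exists_mem_inertia_cyclotomicCharacter_ne_one ℓ hℓv h𝔓
  exact exists_eq_smul_one_of_equivariant_of_isUnit_hasseCoeff_of_mem_inertia W ℓ hℓv hℓ2 hCM hΔ
    hA h𝔓 hτ hχ hnl G hG

/-- **The named core fact at a place `v ∣ ℓ` of good ordinary reduction** (`ℓ` odd):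
`exists_eq_smul_one_of_equivariant_of_not_hasRationalCM W ℓ` (`FaltingsECEndCore`) holds for a
curve with an ordinary good model at some `v ∣ ℓ` — the hypothesis `End_K(E) = ℤ` being
superfluous for such `(E, ℓ)`. [cite: Faltings1983Endlichkeit, §5 Satz 4 (⊗ ℚ_ℓ form; case of an ordinary place above ℓ)]
[cite: SerreAbelianLadic1968, IV.2.2 and A.2.2] -/
theorem exists_eq_smul_one_of_equivariant_of_not_hasRationalCM_of_isUnit_hasseCoeff
    [NumberField K] {v : HeightOneSpectrum (𝓞 K)} (hℓv : (ℓ : 𝓞 K) ∈ v.asIdeal) (hℓ2 : ℓ ≠ 2)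
    {C : VariableChange (v.adicCompletion K)} {M : WeierstrassCurve (v.adicCompletionIntegers K)}
    (hCM : C • W.baseChange (v.adicCompletion K) =
      M.map (algebraMap (v.adicCompletionIntegers K) (v.adicCompletion K))) (hΔ : IsUnit M.Δ)
    (hA : IsUnit (M.hasseCoeff ℓ)) :
    exists_eq_smul_one_of_equivariant_of_not_hasRationalCM W ℓ := by
  intro _ _ _ hnl G hG
  exact exists_eq_smul_one_of_equivariant_of_isUnit_hasseCoeff W ℓ hℓv hℓ2 hCM hΔ hA hnl G hG

/-- **Faltings' Satz 4 for an elliptic curve with an ordinary good place above `ℓ`**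
(unconditional; `ℓ` odd): the named fact `mem_span_range_tateEndRingHom_iff W ℓ`
(`End_K(E) ⊗ ℤ_ℓ ≅ End_{Γ_K}(T_ℓ E)`), by the tree's reduction to the core fact (Shafarevich, AEC
IX.6.2). [cite: Faltings1983Endlichkeit, §5 Satz 4 (case of an ordinary place above ℓ)] -/
theorem mem_span_range_tateEndRingHom_iff_of_isUnit_hasseCoeff [NumberField K]
    {v : HeightOneSpectrum (𝓞 K)} (hℓv : (ℓ : 𝓞 K) ∈ v.asIdeal) (hℓ2 : ℓ ≠ 2)
    {C : VariableChange (v.adicCompletion K)} {M : WeierstrassCurve (v.adicCompletionIntegers K)}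
    (hCM : C • W.baseChange (v.adicCompletion K) =
      M.map (algebraMap (v.adicCompletionIntegers K) (v.adicCompletion K))) (hΔ : IsUnit M.Δ)
    (hA : IsUnit (M.hasseCoeff ℓ)) : mem_span_range_tateEndRingHom_iff W ℓ := by
  -- tactic form: a term-mode proof trips the `overlappingInstances` linter on the outer and the
  -- fact's own `[NumberField K]` binder
  intro _ _
  exact mem_span_range_tateEndRingHom_iff_of_isogenyClass_of_core W ℓ (finite_isogenyClass_holds W)
    (exists_eq_smul_one_of_equivariant_of_not_hasRationalCM_of_isUnit_hasseCoeff W ℓ hℓv hℓ2 hCM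
      hΔ hA)

/-- **Faltings' subspace statement for `E × E` for a curve with an ordinary good place above `ℓ`**
(unconditional; `ℓ` odd): the named fact `stable_subspace_prod_eq_range W ℓ` of
`FaltingsECSubspaces`. [cite: Faltings1983Endlichkeit, §5, Sätze 3–4 (case of an ordinary place above ℓ)] -/
theorem stable_subspace_prod_eq_range_of_isUnit_hasseCoeff [NumberField K]
    {v : HeightOneSpectrum (𝓞 K)} (hℓv : (ℓ : 𝓞 K) ∈ v.asIdeal) (hℓ2 : ℓ ≠ 2)
    {C : VariableChange (v.adicCompletion K)} {M : WeierstrassCurve (v.adicCompletionIntegers K)}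
    (hCM : C • W.baseChange (v.adicCompletion K) =
      M.map (algebraMap (v.adicCompletionIntegers K) (v.adicCompletion K))) (hΔ : IsUnit M.Δ)
    (hA : IsUnit (M.hasseCoeff ℓ)) : stable_subspace_prod_eq_range W ℓ := by
  intro _ _
  exact stable_subspace_prod_eq_range_of_core W ℓ
    (exists_eq_smul_one_of_equivariant_of_not_hasRationalCM_of_isUnit_hasseCoeff W ℓ hℓv hℓ2 hCM
      hΔ hA)

/-- **Faltings' Korollar 1 for `(E, E)` for a curve with an ordinary good place above `ℓ`**
(unconditional; `ℓ` odd): the named fact `mem_span_range_tateModule_map_of_equivariant W W ℓ`.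
[cite: Faltings1983Endlichkeit, §5 Satz 4, Korollar 1 (case of an ordinary place above ℓ)] -/
theorem mem_span_range_tateModule_map_of_equivariant_self_of_isUnit_hasseCoeff [NumberField K]
    {v : HeightOneSpectrum (𝓞 K)} (hℓv : (ℓ : 𝓞 K) ∈ v.asIdeal) (hℓ2 : ℓ ≠ 2)
    {C : VariableChange (v.adicCompletion K)} {M : WeierstrassCurve (v.adicCompletionIntegers K)}
    (hCM : C • W.baseChange (v.adicCompletion K) =
      M.map (algebraMap (v.adicCompletionIntegers K) (v.adicCompletion K))) (hΔ : IsUnit M.Δ)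
    (hA : IsUnit (M.hasseCoeff ℓ)) : mem_span_range_tateModule_map_of_equivariant W W ℓ := by
  intro _ _ _
  exact mem_span_range_tateModule_map_of_equivariant_self_of_isogenyClass_of_core W ℓ
    (finite_isogenyClass_holds W)
    (exists_eq_smul_one_of_equivariant_of_not_hasRationalCM_of_isUnit_hasseCoeff W ℓ hℓv hℓ2 hCM
      hΔ hA)

/-- **What is left of the core fact after the ordinary places above `ℓ`.**  Over a number field the
named fact `exists_eq_smul_one_of_equivariant_of_not_hasRationalCM W ℓ` reduces to the case:
`E` has no complex multiplication over `K̄`, `K` is totally imaginary, `j(E)` is integral at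
every finite place `v ∤ ℓ`, **and** either `ℓ = 2` or no place `v ∣ ℓ` carries a good model of
`E` over `𝓞_v` with unit Hasse invariant (i.e. `E` is potentially supersingular or of bad
reduction at every place above `ℓ`, as far as models over `K_v` go) — the previous residual
(`exists_eq_smul_one_of_equivariant_of_not_hasRationalCM_of_residual`, potential-CM / real place /
`ord_v(j) < 0` cases) sharpened by `…_of_isUnit_hasseCoeff`.  This remaining case is Serre's
theorem for a totally imaginary field at a supersingular or unstable `ℓ` (1968, IV.2.2 via
Hodge–Tate decompositions, III; or Faltings' Finiteness I).
[cite: SerreAbelianLadic1968, IV.2.2] [cite: Faltings1983Endlichkeit, §5 Satz 4] -/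
theorem exists_eq_smul_one_of_equivariant_of_not_hasRationalCM_of_residual' [NumberField K]
    [W.IsElliptic]
    (h : ¬ W.HasCM → IsEmpty (K →+* ℝ) →
      (∀ v : HeightOneSpectrum (𝓞 K), (ℓ : 𝓞 K) ∉ v.asIdeal → v.valuation K W.j ≤ 1) →
      (ℓ = 2 ∨ ∀ (v : HeightOneSpectrum (𝓞 K)) (C : VariableChange (v.adicCompletion K))
          (M : WeierstrassCurve (v.adicCompletionIntegers K)), (ℓ : 𝓞 K) ∈ v.asIdeal →
          C • W.baseChange (v.adicCompletion K) =
            M.map (algebraMap (v.adicCompletionIntegers K) (v.adicCompletion K)) →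
          IsUnit M.Δ → ¬ IsUnit (M.hasseCoeff ℓ)) →
      exists_eq_smul_one_of_equivariant_of_not_hasRationalCM W ℓ) :
    exists_eq_smul_one_of_equivariant_of_not_hasRationalCM W ℓ := by
  refine exists_eq_smul_one_of_equivariant_of_not_hasRationalCM_of_residual W ℓ
    fun hCM hR hj ↦ ?_
  by_cases hℓ2 : ℓ = 2
  · exact h hCM hR hj (Or.inl hℓ2)
  by_cases hord : ∀ (v : HeightOneSpectrum (𝓞 K)) (C : VariableChange (v.adicCompletion K))
      (M : WeierstrassCurve (v.adicCompletionIntegers K)), (ℓ : 𝓞 K) ∈ v.asIdeal →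
      C • W.baseChange (v.adicCompletion K) =
        M.map (algebraMap (v.adicCompletionIntegers K) (v.adicCompletion K)) →
      IsUnit M.Δ → ¬ IsUnit (M.hasseCoeff ℓ)
  · exact h hCM hR hj (Or.inr hord)
  · push Not at hord
    obtain ⟨v, C, M, hℓv, hCM', hΔ, hA⟩ := hord
    exact exists_eq_smul_one_of_equivariant_of_not_hasRationalCM_of_isUnit_hasseCoeff W ℓ hℓv hℓ2
      hCM' hΔ hA

end Ordinary


end Literature.AlgebraicGeometry.Motives

end
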